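import Summits.CriticalPhenomena.PercolationContinuityZ3.Theorems.Transplant.FKConnectivityAllQAntipodalRootFormCert

/-!
# Connectivity correlation inequalities for `φ_{w,q}`, every `q > 0` — ROOT-FORM CALCULUS, file 61f: the certificate of base (B2) (the SERIES
# pair `B_y · B_z`) as a kernel-checked table

Support file (`--supports stmt-CriticalPhenomena-4575`), FK sub-lane `prim-bschramm-fk-2` (gen 28); builds on p205010 (kernel theorem, internal audit
signed; external expert review pending).  Standard axioms, no sorries.  Memo FROM-fk-2-g28-ROOT-FORM.md §6 (certificate kit j207899: 42 single-box
instances A2 / A3n / A4both / A4n, every multiplier 1, keyed by the partner's connection class) and §7.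

Same shape as file 61d (`Cert`): type-level integrands over `ℤ`, now for the series pair — levels add, the poles of `B_y · B_z` are joined in a
replica iff BOTH boxes join their poles there —, the certificate `certYS, certZS`, the residual `rhoS` and `rhoS_nonneg` (window by `decide +kernel`,
saturation outside).  The base (B2) of the root-form reduction for hosts whose `x,y,z`-median is an S-node (triangle assembly Δ). [folklore]
-/

namespace Summit.CriticalPhenomena.PercolationContinuityZ3.Theorems

namespace FK

namespace RootForm

namespace Cert

/-- A2 (pivot at the special, virtual root deleted): `[L⁰ ≤ K] − [L¹ ≤ K]`. [folklore] -/
def A2 (t : BT) (K : ℤ) : ℤ := I (0 ≤ K) - I (t.dL ≤ K)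

/-- level of the series pair at states `(a,b)` relative to `L⁰_y + L⁰_z`. [folklore] -/
def plamS (ty tz : BT) (a b : Bool) : ℤ := lev ty a + lev tz b
/-- pole bit of the series pair in replica 1 (both boxes joined). [folklore] -/
def C1S (ty tz : BT) (a b : Bool) : ℤ := bi (ccB ty a && ccB tz b)
/-- pole bit of the series pair in replica 2. [folklore] -/
def C2S (ty tz : BT) (a b : Bool) : ℤ := bi (cbB ty a && cbB tz b)
/-- slot-1 integrand of `M̃_{B_y·B_z}` at `k = J − L⁰_y − L⁰_z`. [folklore] -/
def X1S (ty tz : BT) (k : ℤ) : ℤ :=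
  I (plamS ty tz false false + C1S ty tz false false ≤ k) - I (plamS ty tz true true + C1S ty tz true true ≤ k)
  + I (plamS ty tz true false = k) * C1S ty tz true false + I (plamS ty tz false true = k) * C1S ty tz false true
/-- slot-0 integrand of `M̃_{B_y·B_z}`. [folklore] -/
def X0S (ty tz : BT) (k : ℤ) : ℤ :=
  I (plamS ty tz false false + C2S ty tz false false ≤ k) - I (plamS ty tz true true + C2S ty tz true true ≤ k)
  - I (plamS ty tz true false = k) * C2S ty tz true false - I (plamS ty tz false true = k) * C2S ty tz false true

/-- y-side of the (B2) certificate (generators of box `y`, keyed by the class of `t_z`): thresholds `K0 = k`, `K1 = k − dL_z`;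
returns (slot-1 part, slot-0 part). [folklore] -/
def certYS (ty tz : BT) (K0 K1 : ℤ) : ℤ × ℤ :=
  ((isC tz false false false false + isC tz false false true false + isC tz false true false false + isC tz true true false false
      + isC tz true true true false) * A2 ty K1 + isC tz false true true false * A2 ty K0
      + (isC tz false false true true + isC tz false true true true + isC tz true true true true) * A3u ty K1
      + isC tz true true true false * A4u ty K0,
    (isC tz false false false false + isC tz false false true false + isC tz false true false false + isC tz true true false false
      + isC tz true true true false) * A2 ty K1 + isC tz false true true false * A2 ty K0
      + (isC tz false false true true + isC tz false true true true + isC tz true true true true) * A3l ty K1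
      + (isC tz false false true false + isC tz false false true true + isC tz false true true false + isC tz false true true true
          + isC tz true true true true) * (A4u ty K0 + A4l ty K0)
      + isC tz true true true false * A4l ty K0)

/-- z-side of the (B2) certificate (generators of box `z`, keyed by the class of `t_y`): thresholds `K0 = k`, `K1 = k − dL_y`. [folklore] -/
def certZS (ty tz : BT) (K0 K1 : ℤ) : ℤ × ℤ :=
  ((isC ty false false false false + isC ty false false true false + isC ty false false true true + isC ty false true false false
      + isC ty false true true false + isC ty false true true true) * A2 tz K0
      + (isC ty true true false false + isC ty true true true false + isC ty true true true true) * A3u tz K0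
      + (isC ty false true false false + isC ty true true false false + isC ty true true true false + isC ty true true true true)
          * (A4u tz K1 + A4l tz K1)
      + isC ty false true true false * A4u tz K0 + isC ty false true true true * A4u tz K1,
    (isC ty false false false false + isC ty false false true false + isC ty false false true true + isC ty false true false false
      + isC ty false true true false + isC ty false true true true) * A2 tz K0
      + (isC ty true true false false + isC ty true true true false + isC ty true true true true) * A3l tz K0
      + isC ty false true true false * A4l tz K0 + isC ty false true true true * A4l tz K1)

/-- residual of the (B2) certificate. [folklore] -/
def rhoS (ty tz : BT) (k : ℤ) : ℤ × ℤ :=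
  (X1S ty tz k - (certYS ty tz k (k - tz.dL)).1 - (certZS ty tz k (k - ty.dL)).1,
   X0S ty tz k - (certYS ty tz k (k - tz.dL)).2 - (certZS ty tz k (k - ty.dL)).2)

/-- the transport conditions at one row. [folklore] -/
def checkRowS (ty tz : BT) (k : ℤ) : Bool :=
  decide (0 ≤ (rhoS ty tz k).1) && decide (0 ≤ (rhoS ty tz k).1 + (rhoS ty tz k).2)

/-- all rows of the window. [folklore] -/
def checkAllS : Bool := T21.all fun ty => T21.all fun tz => ks.all fun k => checkRowS ty tz k

/-- **The (B2) certificate is valid on the window.** [folklore] -/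
theorem checkAllS_true : checkAllS = true := by decide +kernel

/-- Residual conditions inside the window. [folklore] -/
theorem rhoS_window (ty tz : BT) (hy : consistentB ty = true) (hz : consistentB tz = true) (k : ℤ) (h1 : -8 ≤ k) (h2 : k ≤ 9) :
    0 ≤ (rhoS ty tz k).1 ∧ 0 ≤ (rhoS ty tz k).1 + (rhoS ty tz k).2 := by
  have h := checkAllS_true
  rw [checkAllS, List.all_eq_true] at h
  have h' := h ty (mem_T21 ty hy); rw [List.all_eq_true] at h'
  have h'' := h' tz (mem_T21 tz hz); rw [List.all_eq_true] at h''
  have h3 := h'' k (mem_ks k h1 h2)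
  simp only [checkRowS, Bool.and_eq_true, decide_eq_true_eq] at h3
  exact h3

/-- A2 vanishes far from the support. [folklore] -/
theorem A2_sat (t : BT) (hd : -1 ≤ t.dL ∧ t.dL ≤ 1) (K : ℤ) (hK : K ≤ -3 ∨ 3 ≤ K) : A2 t K = 0 := by
  unfold A2; rcases hK with hK | hK
  · rw [I_le_false (by omega), I_le_false (by omega)]; simp
  · rw [I_le_true (by omega), I_le_true (by omega)]; simp
/-- bounds of the series-pair level. [folklore] -/
theorem plamS_bound (ty tz : BT) (hy : -1 ≤ ty.dL ∧ ty.dL ≤ 1) (hz : -1 ≤ tz.dL ∧ tz.dL ≤ 1) (a b : Bool) :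
    -2 ≤ plamS ty tz a b ∧ plamS ty tz a b ≤ 2 := by
  unfold plamS lev; cases a <;> cases b <;> simp <;> omega
/-- bounds of the series-pair pole bits. [folklore] -/
theorem C1S_bound (ty tz : BT) (a b : Bool) : 0 ≤ C1S ty tz a b ∧ C1S ty tz a b ≤ 1 := bi_bound _
/-- see `C1S_bound`. [folklore] -/
theorem C2S_bound (ty tz : BT) (a b : Bool) : 0 ≤ C2S ty tz a b ∧ C2S ty tz a b ≤ 1 := bi_bound _
/-- `X1S` vanishes far from the support. [folklore] -/
theorem X1S_sat (ty tz : BT) (hy : -1 ≤ ty.dL ∧ ty.dL ≤ 1) (hz : -1 ≤ tz.dL ∧ tz.dL ≤ 1) (k : ℤ) (hk : k ≤ -5 ∨ 6 ≤ k) :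
    X1S ty tz k = 0 := by
  have p00 := plamS_bound ty tz hy hz false false; have p11 := plamS_bound ty tz hy hz true true
  have p10 := plamS_bound ty tz hy hz true false; have p01 := plamS_bound ty tz hy hz false true
  have c00 := C1S_bound ty tz false false; have c11 := C1S_bound ty tz true true
  unfold X1S; rcases hk with hk | hk
  · rw [I_le_false (by omega), I_le_false (by omega), I_eq_false (by omega), I_eq_false (by omega)]; simp
  · rw [I_le_true (by omega), I_le_true (by omega), I_eq_false (by omega), I_eq_false (by omega)]; simp
/-- `X0S` vanishes far from the support. [folklore] -/
theorem X0S_sat (ty tz : BT) (hy : -1 ≤ ty.dL ∧ ty.dL ≤ 1) (hz : -1 ≤ tz.dL ∧ tz.dL ≤ 1) (k : ℤ) (hk : k ≤ -5 ∨ 6 ≤ k) :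
    X0S ty tz k = 0 := by
  have p00 := plamS_bound ty tz hy hz false false; have p11 := plamS_bound ty tz hy hz true true
  have p10 := plamS_bound ty tz hy hz true false; have p01 := plamS_bound ty tz hy hz false true
  have c00 := C2S_bound ty tz false false; have c11 := C2S_bound ty tz true true
  unfold X0S; rcases hk with hk | hk
  · rw [I_le_false (by omega), I_le_false (by omega), I_eq_false (by omega), I_eq_false (by omega)]; simp
  · rw [I_le_true (by omega), I_le_true (by omega), I_eq_false (by omega), I_eq_false (by omega)]; simp

/-- Outside the window the (B2) residual vanishes. [folklore] -/
theorem rhoS_sat (ty tz : BT) (hy : consistentB ty = true) (hz : consistentB tz = true) (k : ℤ) (hk : k ≤ -9 ∨ 10 ≤ k) :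
    rhoS ty tz k = (0, 0) := by
  have dy := dL_bound ty hy; have dz := dL_bound tz hz
  have hX1 := X1S_sat ty tz dy dz k (by omega); have hX0 := X0S_sat ty tz dy dz k (by omega)
  simp only [rhoS, certYS, certZS, hX1, hX0,
    A2_sat ty dy k (by omega), A2_sat ty dy (k - tz.dL) (by omega), A2_sat tz dz k (by omega),
    A3u_sat ty dy (k - tz.dL) (by omega), A3l_sat ty dy (k - tz.dL) (by omega), A3u_sat tz dz k (by omega), A3l_sat tz dz k (by omega),
    A4u_sat ty dy k (by omega), A4l_sat ty k (by omega), A4u_sat tz dz k (by omega), A4l_sat tz k (by omega),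
    A4u_sat tz dz (k - ty.dL) (by omega), A4l_sat tz (k - ty.dL) (by omega)]
  simp

/-- **Residual of the (B2) certificate**: `ρ₁ ≥ 0` and `ρ₁ + ρ₀ ≥ 0` for all consistent type pairs and every offset. [folklore] -/
theorem rhoS_nonneg (ty tz : BT) (hy : consistentB ty = true) (hz : consistentB tz = true) (k : ℤ) :
    0 ≤ (rhoS ty tz k).1 ∧ 0 ≤ (rhoS ty tz k).1 + (rhoS ty tz k).2 := by
  by_cases hk : k ≤ -9 ∨ 10 ≤ k
  · rw [rhoS_sat ty tz hy hz k hk]; simp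
  · exact rhoS_window ty tz hy hz k (by omega) (by omega)

end Cert

end RootForm

end FK

end Summit.CriticalPhenomena.PercolationContinuityZ3.Theorems
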